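import Mathlib.Algebra.Order.Archimedean.Real.Basic
import Mathlib.Order.ConditionallyCompleteLattice.Basic
import Mathlib.Data.Set.Finite.Lattice
import HarnessLib

/-!
# K. Joshi, *Arithmetic Teichmüller spaces III* (arXiv:2401.13508v4) §7.9: theta-values loci and compactly
# bounded subsets of `M_{1,1}(Q̄)`

Block E of the abc-iut cell (rung LADDER-ABC:A2.E; seat abc-iut-E-t15, slot T-15; inventory
`plan/E/t15/INVENTORY.tsv`; companion of `Joshi/ThetaLociProducts.lean` = §7.8). TYPING ONLY of [J-III] = K. Joshi,
arXiv:2401.13508v4 ("Preliminary version for comments", unrefereed; bib `Joshi2024ATS3`) §7.9, PDF p.70 l.11–67 of the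
cell's render `lit/renders/Joshi-arxiv-2401.13508/p0070.txt` («p.N l.M» = line M of PDF page N; printed page = PDF
page − 1). The paragraph opens "This paragraph is not needed in the main proofs" (l.11–12) and consists of a
definition the author only "tempt[s] to expect … makes sense" ((7.9.1)), an expectation he REJECTS ((7.9.2): "too
optimistic"), and an expectation he does not claim to prove ((7.9.3): "one can expect to prove"); per
plan/E/ASSIGNMENTS.md it "feeds [J-IV] §5" (E5). Accordingly NOTHING here is asserted, by Joshi or by this file:
the two displayed finiteness statements are `Prop`-valued predicates whose `@[claim]` tag records provenance only,
and what follows from the signature is a proved `theorem`. No side is taken on [IUTchIII] Cor. 3.12, on Joshi's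
claims, or on Mochizuki's reports on them; typed ≠ proved ≠ endorsed.

AS PRINTED (p.70). l.14–17: "I have suppressed from the notation `Θ̂^{B̆}_Joshi` the dependence of this set on `X/L`
(and `ℓ`). I will ignore `ℓ` for the moment and write `Θ̂^{B̆}_Joshi(X/L)`". l.18–27: "Let `M_{1,1}(L)` be the `L`-valued
points of moduli stack `M_{1,1}` … it is tempting to expect that the following makes sense: (7.9.1)
`Θ̂^{B̆}_Joshi(M_{1,1}(L)) = ⋃_{X/L ∈ M_{1,1}(L)} Θ̂^{B̆}_Joshi(X/L)` and expect that (7.9.2) `|Θ̂^{B̆}_Joshi(M_{1,1}(L))|_{B̆} < ∞`.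
Especially if this is true then any upper bound for it can serve as a uniform upper bound for `Θ̂^{B̆}_Joshi(X/L)` for
every `X/L`." l.42–45: "However eq. (7.9.2) is too optimistic … the field `L′` will vary as the curve varies in
moduli in general (the degree `L′/L` remains bounded by Lemma 3.4.2.1)." l.46–65: "such bounds may exist for arbitrary
choice of compactly bounded subsets of `M_{1,1}(Q̄)` (see [Mochizuki, 2010] …). Let `Q̄_{≤d}` be the union of all
finite extensions of `ℚ` … of degrees bounded by the `d` … For `K ⊂ M_{1,1}(Q̄)` a compactly bounded subset supported
at a finite set of rational primes `Σ` one can expect to define `Θ̂^{B̆}_Joshi(K ∩ M_{1,1}(Q̄_{≤d}))` and one can expect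
to prove that (7.9.3) `|Θ̂^{B̆}_Joshi(K ∩ M_{1,1}(Q̄_{≤d}))|_{B̆} < ∞`." l.66–67: "Very roughly this is the idea behind the
computations of [Mochizuki, 2021d, Corollary 2.2]".

DESIGN. A family of subsets `locus x = Θ̂^{B̆}_Joshi(X/L)` of ONE ambient type `Ω` carrying a real-valued `|·|_{B̆}`,
indexed by a type `M` of moduli points with a degree function (for `Q̄_{≤d}`); `locus x` is MEANT to be the adelic
locus `Joshi.ATS3.AdelicBundlingDatum.hatLocus` of the curve `x` (companion file) embedded in `Ω`. The common
ambient is an explicit MODELLING ASSUMPTION: the author himself notes that the rings vary with the curve through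
`L′` (l.42–45). DICTIONARY (recorded, not adjudicated): "compactly bounded subsets" are [GenEll]'s
(`Literature.NumberTheory.DiophantineGeometry.GenEll.CBData`, `….GenEll.ABCCompactlyBounded`, [GenEll] Thm. 2.1
(ii)); the model computation is [IUTchIV] Cor. 2.2 (`Literature.IUT.LogVolume.Cor22.Corollary22`) — cited by name,
not imported (Joshi's `K ⊂ M_{1,1}(Q̄)`; GenEll's `K_V` lives on the `λ`-line `U_P`); our Cor. 3.12 interface
(`Summit.ABC.IUTFork.Thm311.ThetaIndex`, `Cor312.Setting`) is per initial Θ-data, i.e. per curve — there is no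
moduli-indexed family on our side (nearest object: NONE). Deliberately NOT here: any TEST against
`Cor312.PilotKummerIndRelated` (§7.9 mentions no pilot region and no indeterminacy), any judgement.
-/

noncomputable section

namespace Summit.ABC.IUTFork.Joshi.ATS3

universe uM uΩ

/-- CARRIER of [J-III] §7.9 (SIGNATURE; p.70 l.11–27; nothing asserted): the dependence `X/L ↦ Θ̂^{B̆}_Joshi(X/L)`
as a family of subsets of one ambient type `Ω` with a real-valued `|·|_{B̆}`, indexed by a type `M` of moduli
points (`M_{1,1}(L)`, or `M_{1,1}(Q̄)` with the degree of the field of definition for `Q̄_{≤d}`, p.70 l.47–49). The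
common ambient is a modelling assumption (module docstring). [claim: Joshi2024ATS3, status: disputed] -/
structure ModuliLociFamily (M : Type uM) (Ω : Type uΩ) where
  /-- `|·|_{B̆}` on the common ambient. -/
  norm : Ω → ℝ
  /-- `X/L ↦ Θ̂^{B̆}_Joshi(X/L)` (p.70 l.16–17). -/
  locus : M → Set Ω
  /-- the degree over `ℚ` of the field of definition of a moduli point (for `Q̄_{≤d}`, p.70 l.47–49). -/
  degree : M → ℕ

namespace ModuliLociFamily

variable {M : Type uM} {Ω : Type uΩ} (F : ModuliLociFamily M Ω)

/-- (7.9.1) ([J-III] p.70 l.20–27) for a set `S` of moduli points: `Θ̂^{B̆}_Joshi(S) = ⋃_{X/L ∈ S} Θ̂^{B̆}_Joshi(X/L)`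
(printed for `S = M_{1,1}(L)`; reused for `S = K ∩ M_{1,1}(Q̄_{≤d})` in (7.9.3)). [claim: Joshi2024ATS3, status: disputed] -/
def unionLocus (S : Set M) : Set Ω :=
  ⋃ x ∈ S, F.locus x

/-- The locus of each member lies in the union locus (definitional). PROVED. -/
theorem locus_subset_unionLocus {S : Set M} {x : M} (hx : x ∈ S) : F.locus x ⊆ F.unionLocus S :=
  fun _ hz => Set.mem_biUnion hx hz

/-- The shape of (7.9.2)/(7.9.3) ([J-III] p.70 l.29–38, l.56–65): "`|Θ̂^{B̆}_Joshi(S)|_{B̆} < ∞`", read as: the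
norms on the union locus over `S` are bounded above. A PREDICATE; for `S = M_{1,1}(L)` (7.9.2) the author REJECTS
it ("eq. (7.9.2) is too optimistic", p.70 l.42) — NOT asserted by anyone; the tag records provenance only.
[claim: Joshi2024ATS3, status: disputed] -/
@[claim "Joshi2024ATS3" "disputed"]
def NormBoundedOn (S : Set M) : Prop :=
  BddAbove (F.norm '' F.unionLocus S)

/-- "Especially if this is true then any upper bound for it can serve as a uniform upper bound for
`Θ̂^{B̆}_Joshi(X/L)` for every `X/L ∈ M_{1,1}(L)`" ([J-III] p.70 l.39–41): boundedness of the union locus over `S` is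
EQUIVALENT to one bound valid for every member of the family over `S`. PROVED. -/
theorem normBoundedOn_iff_exists_forall (S : Set M) :
    F.NormBoundedOn S ↔ ∃ C : ℝ, ∀ x ∈ S, ∀ z ∈ F.locus x, F.norm z ≤ C := by
  constructor
  · rintro ⟨C, hC⟩
    exact ⟨C, fun x hx z hz => hC ⟨z, F.locus_subset_unionLocus hx hz, rfl⟩⟩
  · rintro ⟨C, hC⟩
    refine ⟨C, ?_⟩
    rintro _ ⟨z, hz, rfl⟩
    obtain ⟨x, hx, hzx⟩ := Set.mem_iUnion₂.mp hz
    exact hC x hx z hzx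

/-- Boundedness of the union locus passes to sub-families. PROVED. -/
theorem normBoundedOn_mono {S S' : Set M} (h : S' ⊆ S) (hS : F.NormBoundedOn S) : F.NormBoundedOn S' := by
  rw [normBoundedOn_iff_exists_forall] at hS ⊢
  obtain ⟨C, hC⟩ := hS
  exact ⟨C, fun x hx => hC x (h hx)⟩

/-- `M_{1,1}(Q̄_{≤d})`: the moduli points whose field of definition has degree `≤ d` ([J-III] p.70 l.47–49: "`Q̄_{≤d}`
… the union of all finite extensions of `ℚ` … of degrees bounded by the `d` (specified by for example by Lemma
3.4.2.1)"; Joshi-side field-level typing: E-t6's `ATS3.boundedDegreeField`, `ATS3.InitialThetaData.Lemma3421`).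
[claim: Joshi2024ATS3, status: disputed] -/
def degreeLE (d : ℕ) : Set M :=
  {x | F.degree x ≤ d}

/-- `M_{1,1}(Q̄_{≤d'}) ⊆ M_{1,1}(Q̄_{≤d})` for `d' ≤ d`. PROVED. -/
theorem degreeLE_mono {d d' : ℕ} (h : d' ≤ d) : F.degreeLE d' ⊆ F.degreeLE d :=
  fun _ hx => le_trans (b := d') hx h

/-- **(7.9.3) as a typed EXPECTATION** ([J-III] p.70 l.46–65): "For `K ⊂ M_{1,1}(Q̄)` a compactly bounded subset
supported at a finite set of rational primes `Σ` one can expect to define `Θ̂^{B̆}_Joshi(K ∩ M_{1,1}(Q̄_{≤d}))` and one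
can expect to prove that (7.9.3) `|Θ̂^{B̆}_Joshi(K ∩ M_{1,1}(Q̄_{≤d}))|_{B̆} < ∞`"; "Very roughly this is the idea behind
the computations of [IUTchIV, Corollary 2.2]" (l.66–67). Typed on the family over `M = M_{1,1}(Q̄)` for an abstract
subset `Kcb` (compactly bounded in [GenEll]'s sense — our `Literature.NumberTheory.DiophantineGeometry.GenEll.CBData`;
the support `Σ` is not used by the statement) and the degree bound `d`. An EXPECTATION in a paragraph "not needed
in the main proofs": NOT asserted by the author; the tag records provenance only; nothing is asserted here.
[claim: Joshi2024ATS3, status: disputed] -/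
@[claim "Joshi2024ATS3" "disputed"]
def CompactlyBoundedFiniteness (Kcb : Set M) (d : ℕ) : Prop :=
  F.NormBoundedOn (Kcb ∩ F.degreeLE d)

/-- (7.9.3) unfolded: one real bound for `|z|_{B̆}` over all `z ∈ Θ̂^{B̆}_Joshi(X)`, `X ∈ K` of degree `≤ d`. PROVED. -/
theorem compactlyBoundedFiniteness_iff (Kcb : Set M) (d : ℕ) :
    F.CompactlyBoundedFiniteness Kcb d ↔
      ∃ C : ℝ, ∀ x ∈ Kcb, F.degree x ≤ d → ∀ z ∈ F.locus x, F.norm z ≤ C := by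
  rw [CompactlyBoundedFiniteness, normBoundedOn_iff_exists_forall]
  constructor
  · rintro ⟨C, hC⟩
    exact ⟨C, fun x hx hd => hC x ⟨hx, hd⟩⟩
  · rintro ⟨C, hC⟩
    exact ⟨C, fun x hx => hC x hx.1 hx.2⟩

/-- The expectation (7.9.3) is antitone in the subset and in the degree bound. PROVED. -/
theorem compactlyBoundedFiniteness_mono {Kcb Kcb' : Set M} {d d' : ℕ} (hK : Kcb' ⊆ Kcb) (hd : d' ≤ d)
    (h : F.CompactlyBoundedFiniteness Kcb d) : F.CompactlyBoundedFiniteness Kcb' d' :=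
  F.normBoundedOn_mono (Set.inter_subset_inter hK (F.degreeLE_mono hd)) h

/-- (7.9.2) for all of `M` would give (7.9.3) for every sub-family ("any upper bound for it can serve as a uniform
upper bound", p.70 l.39–41) — the direction the author calls "too optimistic" over `M_{1,1}(L)`. PROVED. -/
theorem compactlyBoundedFiniteness_of_normBoundedOn_univ (h : F.NormBoundedOn Set.univ) (Kcb : Set M) (d : ℕ) :
    F.CompactlyBoundedFiniteness Kcb d :=
  F.normBoundedOn_mono (Set.subset_univ _) h

/-- A finite family of individually norm-bounded loci has a norm-bounded union — the elementary mechanism by which a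
bound over a FINITE set of curves is uniform (the author's point, l.42–45, is that `M_{1,1}(L)` is not such a set
while `L′` varies). PROVED (Mathlib `Set.Finite.bddAbove_biUnion`). -/
theorem normBoundedOn_of_finite {S : Set M} (hS : S.Finite) (hb : ∀ x ∈ S, BddAbove (F.norm '' F.locus x)) :
    F.NormBoundedOn S := by
  rw [NormBoundedOn, unionLocus, Set.image_iUnion₂]
  exact (Set.Finite.bddAbove_biUnion hS).mpr hb

end ModuliLociFamily

end Summit.ABC.IUTFork.Joshi.ATS3

end
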